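import Mathlib.Analysis.Calculus.SmoothSeries
import Literature.NumberTheory.LFunctions.WangCriterionArcLemmas
import Literature.NumberTheory.LFunctions.ZetaHalfPlanePoissonJensen
import Literature.NumberTheory.LFunctions.VolchkovTypeIntegralCriteria
import Literature.NumberTheory.LFunctions.ZetaRealAxis
import Literature.NumberTheory.LFunctions.FordZetaZeroRecipSqSum
import Literature.NumberTheory.LFunctions.GeneralizedRH
import HarnessLib

/-!
# RH-EQUIVALENT · Wang's criterion `∫_1^∞ log|ζ(1/2+it)| dt/t² = ∫_0^{π/2} Re(e^{-iθ} log ζ(1/2+e^{iθ})) dθ ⟺ RH` (DISCHARGED) — nothing here bears on the truth of RH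

Literature service of the `rh-lit-broughan-2` tranche (Broughan, *Equivalents of the Riemann
Hypothesis* Vol. 2: the Wang criterion). This file discharges the named fact
`Literature.NumberTheory.LFunctions.Wang1946_criterion` (`VolchkovTypeIntegralCriteria.lean`):
`theorem Wang1946_criterion_holds : Wang1946_criterion`.

## The printed proof and the road taken

Wang [Wang1946] applies Carleman's theorem to `log ζ(1/2 + z)` on the region bounded by the unit
semicircle `K = {|z| = 1, Re z ≥ 0}`, the segments of the imaginary axis `1 ≤ |y| ≤ T` and a large
arc, and lets `T → ∞`: the boundary term on `K` is `2A`, `A = ∫_0^{π/2} Re(e^{-iθ} log ζ(1/2+e^{iθ})) dθ`,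
the term on the imaginary axis is `2∫_1^T log|ζ(1/2+it)| dt/t²`, the interior term is
`2π Σ β_ν/|ρ_ν|²` over the zeros `1/2 + ρ_ν` of `ζ` with `β_ν = Re ρ_ν > 0` — a sum of positive terms,
empty iff RH — and the large arc contributes `O(log T/T)`.

Mathlib has no Green/Carleman contour machinery, and zeros of `ζ` ON the contour (the critical
line) would have to be handled. We run the same bookkeeping through the **Poisson–Jensen
decomposition** instead (all RH-free, proved in the two imported service files):

* `ZetaHalfPlanePoissonJensen.hasSum_poissonJensen_riemannZeta` — for `Re z > 0` off the zeros,
  `log|ζ(1/2+z)| = H(z) + log|z+1/2| − log|z−1/2| − T(z)`, `H = Poisson integral of log|ζ(1/2+it)|`,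
  `T(z) = Σ_{Re ρ>1/2} m(ρ) log(|z + conj ζ_ρ|/|z − ζ_ρ|)`, `ζ_ρ = ρ − 1/2`;
* `WangArc.*` — the arc functional `Arc[v] = ∫_{-π/2}^{π/2} cos θ (∂_r v + v)(e^{iθ}) dθ` of each piece:
  `Arc[H] = ∫_{|t|>1} log|ζ(1/2+it)| dt/t² = 2W` (`arc_poissonIntegral_eq`), `Arc[pole pair] = 0`
  (`arcLog_pole_pair`), `Arc[Blaschke pair of ζ_ρ] = 2π Re ζ_ρ/|ζ_ρ|²` (`arcLog_blaschke_pair`), and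
  `Arc[log|ζ(1/2+·)|] = 2A` by the master identity (`arc_master_identity`) applied to the continuous
  logarithm `L` of the statement on `[0, π/2]` and to `θ ↦ conj L(−θ)` on `[−π/2, 0]`.

Hence `W = A + π S`, `S = Σ_{Re ρ > 1/2} m(ρ) Re ζ_ρ/|ζ_ρ|² ≥ 0` with `S = 0 ⟺` no zero has
`Re ρ > 1/2` `⟺ RH` (`quasiRiemannHypothesis_one_half_iff_holds`). This is exactly Wang's identity
`W = 2π Σ_{γ_ν>0} β_ν/|ρ_ν|² + A` in the limit `T = ∞` (conjugate zeros paired). The zeros of `ζ`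
near the arc are excluded RH-free (`riemannZeta_ne_zero_of_im_pos_of_im_le_fourteen`: no zero has
`0 < |Im s| ≤ 14`; `riemannZeta_neg_of_pos_of_lt_one`: `ζ(1/2) < 0`), and the convergence of `S` and of
the differentiated zero sum comes from `Σ m(ρ)/|ρ|² < ∞` (`FordL33.summable_order_div_norm_sq`).
Finally `WangCriterion.exists_isWangArcLog`: the family of arc logarithms `IsWangArcLog` quantified
over in the criterion is non-empty (§9). No definition, no named fact: theorems only.

## References

* [Wang1946] F. T. Wang, *A note on the Riemann zeta-function*, Bull. Amer. Math. Soc. 52 (1946)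
  319–321 (Lemma; eqs. (1)–(9); final display p. 321).
* [Broughan2017] K. Broughan, *Equivalents of the Riemann Hypothesis*, Vol. 2, CUP 2017 (the Wang
  criterion).
* [Titchmarsh1939] E. C. Titchmarsh, *The Theory of Functions*, 2nd ed., §3.61–§3.71 (Jensen,
  Poisson–Jensen, Carleman).
-/

noncomputable section

open Complex Set Filter MeasureTheory Real intervalIntegral
open scoped Topology ComplexConjugate

namespace Literature.NumberTheory.LFunctions

namespace WangCriterion

/-! ### §1 Zero-freeness of `ζ` near the arc `1/2 + e^{iθ}`, `|θ| ≤ π/2` (RH-free) -/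

/-- No zero of `ζ` has `0 < |Im s| ≤ 14`. [folklore] -/
private theorem zeta_ne_zero_of_abs_im {s : ℂ} (h0 : s.im ≠ 0) (h14 : |s.im| ≤ 14) :
    riemannZeta s ≠ 0 := by
  rcases lt_or_gt_of_ne h0 with hneg | hpos
  · intro hs
    have h1 : riemannZeta (conj s) = 0 := by rw [riemannZeta_conj, hs, map_zero]
    refine riemannZeta_ne_zero_of_im_pos_of_im_le_fourteen (s := conj s) ?_ ?_ h1
    · rw [Complex.conj_im]; linarith
    · rw [Complex.conj_im]; rw [abs_of_neg hneg] at h14; linarith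
  · exact riemannZeta_ne_zero_of_im_pos_of_im_le_fourteen hpos (by rwa [abs_of_pos hpos] at h14)

/-- `ζ(1/2 + z) ≠ 0` for `Re z > 0`, `1/2 < |z| ≤ 3/2`. [folklore] -/
private theorem zeta_half_add_ne_zero {z : ℂ} (hz : 0 < z.re) (h1 : 1 / 2 < ‖z‖) (h2 : ‖z‖ ≤ 3 / 2) :
    riemannZeta (1 / 2 + z) ≠ 0 := by
  by_cases him : z.im = 0
  · have hzre : z = (z.re : ℂ) := by
      rw [← Complex.re_add_im z, him]; simp
    have hnorm : ‖z‖ = z.re := by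
      rw [hzre, Complex.norm_real, Real.norm_of_nonneg hz.le, Complex.ofReal_re]
    refine riemannZeta_ne_zero_of_one_le_re ?_
    simp only [add_re, one_div, Complex.inv_re, Complex.re_ofNat, Complex.normSq_ofNat]
    rw [hnorm] at h1
    norm_num
    linarith
  · apply zeta_ne_zero_of_abs_im
    · simpa using him
    · have : |z.im| ≤ ‖z‖ := Complex.abs_im_le_norm z
      have e : ((1 : ℂ) / 2 + z).im = z.im := by simp
      rw [e]
      linarith

/-- `ζ(1/2 + e^{iθ}) ≠ 0` for `|θ| ≤ π/2`. [folklore] -/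
private theorem zeta_arc_ne_zero {θ : ℝ} (hθ : θ ∈ Icc (-(π / 2)) (π / 2)) :
    riemannZeta (1 / 2 + cexp (θ * I)) ≠ 0 := by
  have hn : ‖cexp (θ * I)‖ = 1 := by rw [Complex.norm_exp_ofReal_mul_I]
  by_cases hc : Real.cos θ = 0
  · -- `θ = ±π/2`: the point `1/2 ± i`
    apply zeta_ne_zero_of_abs_im
    · have hs : Real.sin θ ^ 2 = 1 := by nlinarith [Real.sin_sq_add_cos_sq θ]
      have : ((1 : ℂ) / 2 + cexp (θ * I)).im = Real.sin θ := by
        simp [Complex.exp_ofReal_mul_I_im]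
      rw [this]
      intro h0
      rw [h0] at hs
      norm_num at hs
    · have : ((1 : ℂ) / 2 + cexp (θ * I)).im = Real.sin θ := by
        simp [Complex.exp_ofReal_mul_I_im]
      rw [this]
      linarith [Real.abs_sin_le_one θ]
  · have hcpos : 0 < Real.cos θ := lt_of_le_of_ne (Real.cos_nonneg_of_mem_Icc hθ) (Ne.symm hc)
    refine zeta_half_add_ne_zero ?_ (by rw [hn]; norm_num) (by rw [hn]; norm_num)
    rw [Complex.exp_ofReal_mul_I_re]
    exact hcpos

/-- `ζ(1/2 + it) ≠ 0` for `|t| ≤ 2` (at `t = 0`: `ζ(1/2) < 0`). [folklore] -/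
private theorem zeta_line_ne_zero {t : ℝ} (ht : |t| ≤ 2) : riemannZeta (1 / 2 + t * I) ≠ 0 := by
  by_cases h0 : t = 0
  · rw [h0]
    have h := riemannZeta_re_neg_of_pos_of_lt_one (σ := 1 / 2) (by norm_num) (by norm_num)
    have e : (((1 / 2 : ℝ)) : ℂ) = 1 / 2 + (0 : ℝ) * I := by push_cast; ring
    rw [← e]
    intro hz
    rw [hz, Complex.zero_re] at h
    exact lt_irrefl _ h
  · apply zeta_ne_zero_of_abs_im
    · simpa using h0
    · have e : ((1 : ℂ) / 2 + t * I).im = t := by simp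
      rw [e]
      linarith

/-! ### §2 Calculus: `log|f|` along a path, continuous logarithms, `θ ↦ e^{iθ}` -/

/-- For `f : ℝ → ℂ` differentiable at `r` with `f(r) ≠ 0`: `d/dr log|f(r)| = Re(f'(r)/f(r))`.
[folklore] -/
private theorem hasDerivAt_log_norm {f : ℝ → ℂ} {f' : ℂ} {r : ℝ} (hf : HasDerivAt f f' r)
    (h0 : f r ≠ 0) : HasDerivAt (fun y ↦ Real.log ‖f y‖) ((f' / f r).re) r := by
  by_cases hs : f r ∈ slitPlane
  · have h1 : HasDerivAt (fun y ↦ Complex.log (f y)) (f' / f r) r := hf.clog_real hs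
    have h2 := Complex.reCLM.hasFDerivAt.comp_hasDerivAt r h1
    have h3 : HasDerivAt (fun y ↦ (Complex.log (f y)).re) ((f' / f r).re) r := by
      simpa [Function.comp_def] using h2
    refine h3.congr_of_eventuallyEq (Eventually.of_forall fun y ↦ ?_)
    exact (Complex.log_re (f y)).symm
  · have hs' : -f r ∈ slitPlane := by
      rw [Complex.mem_slitPlane_iff, not_or, not_lt, not_ne_iff] at hs
      rw [Complex.mem_slitPlane_iff]
      left
      have hre : (f r).re ≠ 0 := by
        intro h
        apply h0
        exact Complex.ext (by simpa using h) (by simpa using hs.2)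
      rw [Complex.neg_re]
      have := lt_of_le_of_ne hs.1 hre
      linarith
    have h1 : HasDerivAt (fun y ↦ Complex.log (-f y)) (-f' / -f r) r := hf.neg.clog_real hs'
    have h2 := Complex.reCLM.hasFDerivAt.comp_hasDerivAt r h1
    have h3 : HasDerivAt (fun y ↦ (Complex.log (-f y)).re) ((f' / f r).re) r := by
      have e : -f' / -f r = f' / f r := neg_div_neg_eq _ _
      simpa [Function.comp_def, e] using h2
    refine h3.congr_of_eventuallyEq (Eventually.of_forall fun y ↦ ?_)
    have := (Complex.log_re (-f y)).symm
    rwa [norm_neg] at this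

/-- **A continuous logarithm is differentiable.** If `L` is continuous at `θ`, `exp L = F` near `θ`,
and `F` is differentiable at `θ` with `F(θ) ≠ 0`, then `L` has derivative `F'(θ)/F(θ)` at `θ`
(locally `L = L(θ) + Log(F/F(θ))` with the principal branch). [folklore] -/
private theorem hasDerivAt_of_exp_eq {L F : ℝ → ℂ} {F' : ℂ} {θ : ℝ} (hL : ContinuousAt L θ)
    (hexp : ∀ᶠ t in 𝓝 θ, cexp (L t) = F t) (hF : HasDerivAt F F' θ) (hF0 : F θ ≠ 0) :
    HasDerivAt L (F' / F θ) θ := by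
  have h1 : ∀ᶠ t in 𝓝 θ, ‖L t - L θ‖ < π := by
    have := Metric.tendsto_nhds.1 hL π Real.pi_pos
    simpa [dist_eq_norm] using this
  have hexpθ : cexp (L θ) = F θ := hexp.self_of_nhds
  have h2 : ∀ᶠ t in 𝓝 θ, L t = L θ + Complex.log (F t / F θ) := by
    filter_upwards [h1, hexp] with t ht hFt
    have him : |(L t - L θ).im| < π := lt_of_le_of_lt (Complex.abs_im_le_norm _) ht
    have e : cexp (L t - L θ) = F t / F θ := by rw [Complex.exp_sub, hFt, hexpθ]
    rw [← e, Complex.log_exp (by linarith [(abs_lt.1 him).1]) (abs_lt.1 him).2.le]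
    ring
  have hq : HasDerivAt (fun t ↦ F t / F θ) (F' / F θ) θ := hF.div_const (F θ)
  have hq1 : F θ / F θ = 1 := div_self hF0
  have hlog : HasDerivAt (fun t ↦ Complex.log (F t / F θ)) ((F' / F θ) / (F θ / F θ)) θ :=
    hq.clog_real (by rw [hq1]; exact Complex.one_mem_slitPlane)
  have h3 : HasDerivAt (fun t ↦ L θ + Complex.log (F t / F θ)) (F' / F θ) θ := by
    have := hlog.const_add (L θ)
    rw [hq1, div_one] at this
    exact this
  exact h3.congr_of_eventuallyEq h2

/-- `d/dθ e^{iθ} = i e^{iθ}`. [folklore] -/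
private theorem hasDerivAt_expI (θ : ℝ) : HasDerivAt (fun θ : ℝ ↦ cexp (θ * I)) (I * cexp (θ * I)) θ := by
  have := ((hasDerivAt_id θ).ofReal_comp.mul_const I).cexp
  simpa [mul_comm] using this

/-- `ζ` is analytic at every `s ≠ 1`. [folklore] -/
private theorem analyticAt_riemannZeta {s : ℂ} (hs : s ≠ 1) : AnalyticAt ℂ riemannZeta s := by
  refine Complex.analyticAt_iff_eventually_differentiableAt.2 ?_
  filter_upwards [isOpen_ne.mem_nhds hs] with z hz
  exact differentiableAt_riemannZeta hz

/-- `1/2 + e^{iθ} ≠ 1`. [folklore] -/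
private theorem half_add_expI_ne_one (θ : ℝ) : (1 : ℂ) / 2 + cexp (θ * I) ≠ 1 := by
  intro h
  have h1 : cexp (θ * I) = 1 / 2 := by linear_combination h
  have := congrArg (fun w : ℂ ↦ ‖w‖) h1
  simp only [Complex.norm_exp_ofReal_mul_I] at this
  norm_num at this

/-- `θ ↦ ζ(1/2 + e^{iθ})` has derivative `ζ'(1/2 + e^{iθ}) · i e^{iθ}`. [folklore] -/
private theorem hasDerivAt_zeta_arc (θ : ℝ) :
    HasDerivAt (fun θ : ℝ ↦ riemannZeta (1 / 2 + cexp (θ * I)))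
      (deriv riemannZeta (1 / 2 + cexp (θ * I)) * (I * cexp (θ * I))) θ := by
  have hg : HasDerivAt (fun θ : ℝ ↦ (1 : ℂ) / 2 + cexp (θ * I)) (I * cexp (θ * I)) θ :=
    (hasDerivAt_expI θ).const_add _
  exact ((differentiableAt_riemannZeta (half_add_expI_ne_one θ)).hasDerivAt).comp θ hg

/-- `θ ↦ ζ(1/2 + e^{iθ})` and `θ ↦ ζ'(1/2 + e^{iθ})` are continuous. [folklore] -/
private theorem continuous_zeta_arc :
    Continuous (fun θ : ℝ ↦ riemannZeta (1 / 2 + cexp (θ * I))) ∧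
      Continuous (fun θ : ℝ ↦ deriv riemannZeta (1 / 2 + cexp (θ * I))) := by
  have hγ : Continuous fun θ : ℝ ↦ (1 : ℂ) / 2 + cexp (θ * I) :=
    continuous_const.add (Complex.continuous_exp.comp (Complex.continuous_ofReal.mul continuous_const))
  refine ⟨continuous_iff_continuousAt.2 fun θ ↦ ?_, continuous_iff_continuousAt.2 fun θ ↦ ?_⟩
  · exact ContinuousAt.comp (f := fun θ : ℝ ↦ (1 : ℂ) / 2 + cexp (θ * I))
      (differentiableAt_riemannZeta (half_add_expI_ne_one θ)).continuousAt hγ.continuousAt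
  · exact ContinuousAt.comp (f := fun θ : ℝ ↦ (1 : ℂ) / 2 + cexp (θ * I))
      (analyticAt_riemannZeta (half_add_expI_ne_one θ)).deriv.continuousAt hγ.continuousAt

/-! ### §3 The arc term: `∫ cos θ (Re(e ζ'/ζ) + log|ζ|)(1/2 + e^{iθ}) dθ` over a sub-arc carrying a
continuous logarithm -/

/-- **Master identity for a continuous logarithm of `ζ(1/2 + e^{iθ})`.** If `G` is continuous on
`[a, b] ⊆ [−π/2, π/2]` with `exp G(θ) = ζ(1/2 + e^{iθ})` there, then
`∫_a^b cos θ (Re(e^{iθ} ζ'/ζ(1/2+e^{iθ})) + log|ζ(1/2+e^{iθ})|) dθ = ∫_a^b Re(e^{-iθ} G(θ)) dθ + (cos b Im G(b) − cos a Im G(a))`.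
[cite: Wang1946, Lemma (the term ∫ R{e^{-iθ} log F(e^{iθ})} dθ on the semicircle K); Titchmarsh1939, §3.71] -/
theorem arc_integral_of_log {a b : ℝ} (hab : a ≤ b) {G : ℝ → ℂ} (hG : ContinuousOn G (Icc a b))
    (hexp : ∀ θ ∈ Icc a b, cexp (G θ) = riemannZeta (1 / 2 + cexp (θ * I)))
    (hsub : Icc a b ⊆ Icc (-(π / 2)) (π / 2)) :
    ∫ θ in a..b, Real.cos θ *
        ((cexp (θ * I) * deriv riemannZeta (1 / 2 + cexp (θ * I)) /
            riemannZeta (1 / 2 + cexp (θ * I))).re +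
          Real.log ‖riemannZeta (1 / 2 + cexp (θ * I))‖) =
      (∫ θ in a..b, (cexp (-(θ * I)) * G θ).re) +
        (Real.cos b * (G b).im - Real.cos a * (G a).im) := by
  set G' : ℝ → ℂ := fun θ ↦ I * (cexp (θ * I) * deriv riemannZeta (1 / 2 + cexp (θ * I)) /
    riemannZeta (1 / 2 + cexp (θ * I))) with hG'def
  have hne : ∀ θ ∈ Icc a b, riemannZeta (1 / 2 + cexp (θ * I)) ≠ 0 :=
    fun θ hθ ↦ zeta_arc_ne_zero (hsub hθ)
  -- `G` is differentiable on `(a, b)` with derivative `G'`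
  have hd : ∀ θ ∈ Ioo a b, HasDerivAt G (G' θ) θ := by
    intro θ hθ
    have hnhds : Icc a b ∈ 𝓝 θ := Icc_mem_nhds hθ.1 hθ.2
    have h1 := hasDerivAt_of_exp_eq (hG.continuousAt hnhds)
      (by filter_upwards [hnhds] with t ht; exact hexp t ht) (hasDerivAt_zeta_arc θ)
      (hne θ (Ioo_subset_Icc_self hθ))
    refine h1.congr_deriv ?_
    rw [hG'def]
    ring
  -- `G'` is continuous on `[a, b]`, hence integrable
  have hG'c : ContinuousOn G' (Icc a b) := by
    have hE : Continuous fun θ : ℝ ↦ cexp (θ * I) :=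
      Complex.continuous_exp.comp (Complex.continuous_ofReal.mul continuous_const)
    exact continuousOn_const.mul (((hE.mul continuous_zeta_arc.2).continuousOn).div
      continuous_zeta_arc.1.continuousOn hne)
  have hM := WangArc.arc_master_identity hab hG hd (hG'c.intervalIntegrable_of_Icc hab)
  rw [← hM]
  refine intervalIntegral.integral_congr fun θ hθ ↦ ?_
  rw [uIcc_of_le hab] at hθ
  congr 1
  rw [hG'def]
  simp only [Complex.mul_im, Complex.I_re, Complex.I_im, zero_mul, one_mul, zero_add]
  congr 1
  rw [← hexp θ hθ, Complex.norm_exp, Real.log_exp]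

/-- Continuity of the arc integrand `cos θ (Re(e ζ'/ζ) + log|ζ|)(1/2 + e^{iθ})` on `[−π/2, π/2]`.
[folklore] -/
private theorem continuousOn_arcIntegrand :
    ContinuousOn (fun θ : ℝ ↦ Real.cos θ *
        ((cexp (θ * I) * deriv riemannZeta (1 / 2 + cexp (θ * I)) /
            riemannZeta (1 / 2 + cexp (θ * I))).re +
          Real.log ‖riemannZeta (1 / 2 + cexp (θ * I))‖)) (Icc (-(π / 2)) (π / 2)) := by
  have hE : Continuous fun θ : ℝ ↦ cexp (θ * I) :=
    Complex.continuous_exp.comp (Complex.continuous_ofReal.mul continuous_const)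
  have hne : ∀ θ ∈ Icc (-(π / 2)) (π / 2), riemannZeta (1 / 2 + cexp (θ * I)) ≠ 0 :=
    fun θ hθ ↦ zeta_arc_ne_zero hθ
  refine Real.continuous_cos.continuousOn.mul (ContinuousOn.add ?_ ?_)
  · exact Complex.continuous_re.comp_continuousOn
      (((hE.mul continuous_zeta_arc.2).continuousOn).div continuous_zeta_arc.1.continuousOn hne)
  · exact ContinuousOn.log (continuous_norm.comp_continuousOn continuous_zeta_arc.1.continuousOn)
      (fun θ hθ ↦ norm_ne_zero_iff.2 (hne θ hθ))

/-- **The arc term equals `2A`.** For a Wang arc logarithm `L` (continuous on `[0, π/2]`, real at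
`0`, `exp L(θ) = ζ(1/2 + e^{iθ})`):
`∫_{-π/2}^{π/2} cos θ (Re(e^{iθ} ζ'/ζ) + log|ζ|)(1/2 + e^{iθ}) dθ = 2 ∫_0^{π/2} Re(e^{-iθ} L(θ)) dθ` — the
master identity on `[0, π/2]` with `L` and on `[−π/2, 0]` with `θ ↦ conj L(−θ)` (the boundary terms
vanish because `Im L(0) = 0`), and the reflection `ζ(conj s) = conj ζ(s)`.
[cite: Wang1946, Lemma and eq. (8)–(9) (the term 2∫_0^{π/2} R{e^{-iθ} log ζ(1/2+e^{iθ})} dθ); Titchmarsh1939, §3.71] -/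
theorem arc_integral_eq_two_A {L : ℝ → ℂ} (hL : IsWangArcLog L) :
    ∫ θ in (-(π / 2))..(π / 2), Real.cos θ *
        ((cexp (θ * I) * deriv riemannZeta (1 / 2 + cexp (θ * I)) /
            riemannZeta (1 / 2 + cexp (θ * I))).re +
          Real.log ‖riemannZeta (1 / 2 + cexp (θ * I))‖) =
      2 * ∫ θ in (0 : ℝ)..(π / 2), (cexp (-(θ * I)) * L θ).re := by
  obtain ⟨hLc, hL0, hLexp⟩ := hL
  have hpi : (0 : ℝ) ≤ π / 2 := by positivity
  have hpi' : -(π / 2) ≤ (0 : ℝ) := by linarith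
  have hfc := continuousOn_arcIntegrand
  have hi1 := (hfc.mono (Icc_subset_Icc le_rfl hpi)).intervalIntegrable_of_Icc (μ := volume) hpi'
  have hi2 := (hfc.mono (Icc_subset_Icc hpi' le_rfl)).intervalIntegrable_of_Icc (μ := volume) hpi
  rw [← intervalIntegral.integral_add_adjacent_intervals hi1 hi2]
  -- on `[0, π/2]` with `G = L`
  have hA1 := arc_integral_of_log hpi hLc hLexp (Icc_subset_Icc hpi' le_rfl)
  -- on `[-π/2, 0]` with `G θ = conj (L (-θ))`
  have hmaps : MapsTo (fun θ : ℝ ↦ -θ) (Icc (-(π / 2)) 0) (Icc 0 (π / 2)) := by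
    intro θ hθ; simp only [mem_Icc] at hθ ⊢; constructor <;> linarith
  have hG2c : ContinuousOn (fun θ : ℝ ↦ conj (L (-θ))) (Icc (-(π / 2)) 0) :=
    Complex.continuous_conj.comp_continuousOn (hLc.comp continuous_neg.continuousOn hmaps)
  have hG2exp : ∀ θ ∈ Icc (-(π / 2)) 0,
      cexp (conj (L (-θ))) = riemannZeta (1 / 2 + cexp (θ * I)) := by
    intro θ hθ
    rw [Complex.exp_conj, hLexp (-θ) (hmaps hθ), ← riemannZeta_conj]
    congr 1
    rw [map_add, ← Complex.exp_conj, map_mul, Complex.conj_ofReal, Complex.conj_I, map_div₀, map_one,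
      map_ofNat]
    push_cast
    ring_nf
  have hA2 := arc_integral_of_log hpi' hG2c hG2exp (Icc_subset_Icc le_rfl hpi)
  rw [hA1, hA2]
  -- the reflected integral is `A` again
  have key : ∀ θ : ℝ, (cexp (-(θ * I)) * conj (L (-θ))).re = (cexp ((θ : ℂ) * I) * L (-θ)).re := by
    intro θ
    rw [← Complex.conj_re (cexp (θ * I) * L (-θ)), map_mul, ← Complex.exp_conj, map_mul,
      Complex.conj_ofReal, Complex.conj_I, mul_neg]
  have hI2 : ∫ θ in (-(π / 2))..0, (cexp (-(θ * I)) * conj (L (-θ))).re =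
      ∫ θ in (0 : ℝ)..(π / 2), (cexp (-(θ * I)) * L θ).re := by
    have e : (fun θ : ℝ ↦ (cexp (-(θ * I)) * conj (L (-θ))).re) =
        fun θ ↦ (fun x : ℝ ↦ (cexp (-(x * I)) * L x).re) (-θ) := by
      funext θ
      rw [key]
      simp only [Complex.ofReal_neg, neg_mul, neg_neg]
    rw [e, intervalIntegral.integral_comp_neg (fun x : ℝ ↦ (cexp (-(x * I)) * L x).re), neg_zero,
      neg_neg]
  rw [hI2, Real.cos_neg, Real.cos_pi_div_two, Real.cos_zero, neg_zero, Complex.conj_im, hL0]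
  ring

/-! ### §4 The boundary data `φ(t) = log|ζ(1/2 + it)|`: measurability, local bound, evenness, and
`∫_{|t|>1} φ(t) dt/t² = 2W` -/

/-- `t ↦ ζ(1/2 + it)` is continuous. [folklore] -/
private theorem continuous_zeta_line : Continuous fun t : ℝ ↦ riemannZeta (1 / 2 + t * I) := by
  have hγ : Continuous fun t : ℝ ↦ (1 : ℂ) / 2 + t * I :=
    continuous_const.add (Complex.continuous_ofReal.mul continuous_const)
  refine continuous_iff_continuousAt.2 fun t ↦ ?_
  have hs : (1 : ℂ) / 2 + t * I ≠ 1 := by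
    intro h
    have := congrArg Complex.re h
    norm_num at this
  exact ContinuousAt.comp (f := fun t : ℝ ↦ (1 : ℂ) / 2 + t * I)
    (differentiableAt_riemannZeta hs).continuousAt hγ.continuousAt

/-- `φ` is measurable. [folklore] -/
private theorem measurable_phi : Measurable fun t : ℝ ↦ Real.log ‖riemannZeta (1 / 2 + t * I)‖ :=
  Real.measurable_log.comp (continuous_norm.measurable.comp continuous_zeta_line.measurable)

/-- `φ` is bounded on `[−2, 2]` (`ζ(1/2+it) ≠ 0` there). [folklore] -/
private theorem phi_bounded :
    ∃ M : ℝ, ∀ t : ℝ, |t| ≤ 2 → |Real.log ‖riemannZeta (1 / 2 + t * I)‖| ≤ M := by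
  have hc : ContinuousOn (fun t : ℝ ↦ Real.log ‖riemannZeta (1 / 2 + t * I)‖) (Icc (-2) 2) :=
    ContinuousOn.log (continuous_norm.comp_continuousOn continuous_zeta_line.continuousOn)
      (fun t ht ↦ norm_ne_zero_iff.2 (zeta_line_ne_zero (abs_le.2 ⟨by linarith [ht.1], ht.2⟩)))
  obtain ⟨M, hM⟩ := isCompact_Icc.exists_bound_of_continuousOn hc
  exact ⟨M, fun t ht ↦ by
    have := hM t (by constructor <;> linarith [(abs_le.1 ht).1, (abs_le.1 ht).2])
    rwa [Real.norm_eq_abs] at this⟩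

/-- `φ` is even: `|ζ(1/2 − it)| = |ζ(1/2 + it)|` (`ζ(conj s) = conj ζ(s)`). [folklore] -/
private theorem phi_neg (t : ℝ) :
    Real.log ‖riemannZeta (1 / 2 + ((-t : ℝ) : ℂ) * I)‖ = Real.log ‖riemannZeta (1 / 2 + t * I)‖ := by
  have e : (1 : ℂ) / 2 + ((-t : ℝ) : ℂ) * I = conj ((1 : ℂ) / 2 + t * I) := by
    rw [map_add, map_mul, Complex.conj_ofReal, Complex.conj_I, map_div₀, map_one, map_ofNat]
    push_cast
    ring
  rw [e, riemannZeta_conj, Complex.norm_conj]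

/-- **The imaginary-axis term equals `2W`.** If `φ/(1+t²) ∈ L¹` then `φ(t)/t²` is integrable on
`{|t| > 1}` and `∫_{|t|>1} φ(t) dt/t² = 2 ∫_1^∞ φ(t) dt/t² = 2 · wangLogIntegral` (evenness of `φ`).
[cite: Wang1946, eq. (1) and (9) (the term 2∫_1^T log|ζ(1/2+it)| dt/t²)] -/
theorem integral_abs_gt_one_eq_two_W
    (hφ : Integrable fun t : ℝ ↦ Real.log ‖riemannZeta (1 / 2 + t * I)‖ / (1 + t ^ 2)) :
    IntegrableOn (fun t : ℝ ↦ Real.log ‖riemannZeta (1 / 2 + t * I)‖ / t ^ 2) {t : ℝ | 1 < |t|} ∧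
      ∫ t in {t : ℝ | 1 < |t|}, Real.log ‖riemannZeta (1 / 2 + t * I)‖ / t ^ 2 =
        2 * wangLogIntegral := by
  set φ : ℝ → ℝ := fun t ↦ Real.log ‖riemannZeta (1 / 2 + t * I)‖ with hφdef
  have hS : MeasurableSet {t : ℝ | 1 < |t|} :=
    measurableSet_lt measurable_const (measurable_id.abs)
  -- integrability on `{|t| > 1}` by domination with `2|φ|/(1+t²)`
  have hint : ∀ S : Set ℝ, S ⊆ {t : ℝ | 1 < |t|} → MeasurableSet S →
      IntegrableOn (fun t : ℝ ↦ φ t / t ^ 2) S := by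
    intro S hSsub hSm
    have hg : IntegrableOn (fun t : ℝ ↦ 2 * (|φ t| / (1 + t ^ 2))) S := by
      have := (hφ.norm.const_mul 2).integrableOn (s := S)
      refine this.congr_fun (fun t _ ↦ ?_) hSm
      simp only [hφdef, Real.norm_eq_abs, abs_div]
      rw [abs_of_pos (by positivity : (0 : ℝ) < 1 + t ^ 2)]
    refine Integrable.mono' hg ?_ ?_
    · exact ((measurable_phi.div (measurable_id.pow_const 2)).aestronglyMeasurable).restrict
    · rw [ae_restrict_iff' hSm]
      refine ae_of_all _ fun t ht ↦ ?_
      have h1 : 1 < |t| := hSsub ht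
      have ht2 : 1 < t ^ 2 := by
        have : 1 < |t| ^ 2 := by nlinarith [abs_nonneg t]
        rwa [sq_abs] at this
      rw [Real.norm_eq_abs, abs_div, abs_of_pos (by positivity : (0 : ℝ) < t ^ 2), div_le_iff₀
        (by positivity : (0 : ℝ) < t ^ 2)]
      rw [mul_div_assoc', div_mul_eq_mul_div, le_div_iff₀ (by positivity : (0 : ℝ) < 1 + t ^ 2)]
      nlinarith [abs_nonneg (φ t)]
  refine ⟨hint _ Subset.rfl hS, ?_⟩
  have hsplit : {t : ℝ | 1 < |t|} = Ioi 1 ∪ Iio (-1) := by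
    ext t; simp only [mem_setOf_eq, mem_union, mem_Ioi, mem_Iio, lt_abs, lt_neg]
  have hdisj : Disjoint (Ioi (1 : ℝ)) (Iio (-1)) :=
    Set.disjoint_left.2 fun t h1 h2 ↦ by simp only [mem_Ioi, mem_Iio] at h1 h2; linarith
  have hI1 : IntegrableOn (fun t : ℝ ↦ φ t / t ^ 2) (Ioi 1) :=
    hint _ (by rw [hsplit]; exact subset_union_left) measurableSet_Ioi
  have hI2 : IntegrableOn (fun t : ℝ ↦ φ t / t ^ 2) (Iio (-1)) :=
    hint _ (by rw [hsplit]; exact subset_union_right) measurableSet_Iio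
  rw [hsplit, setIntegral_union hdisj measurableSet_Iio hI1 hI2]
  have hrefl : ∫ t in Iio (-1), φ t / t ^ 2 = ∫ t in Ioi 1, φ t / t ^ 2 := by
    rw [setIntegral_congr_set Iio_ae_eq_Iic, ← integral_comp_neg_Ioi 1 (fun t : ℝ ↦ φ t / t ^ 2)]
    refine setIntegral_congr_fun measurableSet_Ioi fun t _ ↦ ?_
    simp only [hφdef]
    rw [← phi_neg t, neg_sq]
  rw [hrefl, wangLogIntegral]
  ring

/-! ### §5 The zeros `ζ_ρ = ρ − 1/2`, `Re ρ > 1/2`: sizes, the Blaschke-pair estimates, summability -/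

/-- For a non-trivial zero `ρ`: `|Im ρ| > 14`, hence `‖ρ − 1/2‖ > 14`, `|Im(ρ − 1/2)| > 1`, and
`‖ρ‖² ≤ 2‖ρ − 1/2‖²`. [folklore] -/
private theorem zero_sizes {ρ : ℂ} (hρ : ρ ∈ ZetaZeros.riemannZetaNontrivialZeros) :
    14 < ‖ρ - 1 / 2‖ ∧ 1 < |(ρ - 1 / 2).im| ∧ ‖ρ‖ ^ 2 ≤ 2 * ‖ρ - 1 / 2‖ ^ 2 ∧
      |(ρ - 1 / 2).re| ≤ 1 / 2 := by
  have him : 14 < |ρ.im| := FordL33.fourteen_lt_abs_im ⟨ρ, hρ⟩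
  obtain ⟨-, h0, h1⟩ := mem_riemannZetaNontrivialZeros_iff_holds.1 hρ
  have him' : (ρ - 1 / 2).im = ρ.im := by simp
  have hre' : (ρ - 1 / 2).re = ρ.re - 1 / 2 := by simp
  have h14 : 14 < ‖ρ - 1 / 2‖ := by
    have := Complex.abs_im_le_norm (ρ - 1 / 2)
    rw [him'] at this
    linarith
  refine ⟨h14, by rw [him']; linarith, ?_, by rw [hre', abs_le]; constructor <;> linarith⟩
  rw [Complex.sq_norm, Complex.sq_norm, Complex.normSq_apply, Complex.normSq_apply, him', hre']
  have h196 : 196 < ρ.im * ρ.im := by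
    rcases lt_abs.1 him with h | h <;> nlinarith
  nlinarith

/-- The Blaschke-pair derivative bound: for `‖ζ‖ > 14`, `Re ζ ≥ 0`, `‖w‖ ≤ 3/2`, `‖e‖ = 1`:
`w + conj ζ ≠ 0`, `w − ζ ≠ 0` and `|Re(e/(w + conj ζ)) − Re(e/(w − ζ))| ≤ 3 Re ζ/‖ζ‖²`. [folklore] -/
private theorem blaschke_deriv_bound {ζ w e : ℂ} (hζ : 14 < ‖ζ‖) (hre : 0 ≤ ζ.re) (hw : ‖w‖ ≤ 3 / 2)
    (he : ‖e‖ = 1) :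
    w + conj ζ ≠ 0 ∧ w - ζ ≠ 0 ∧
      |(e / (w + conj ζ)).re - (e / (w - ζ)).re| ≤ 3 * (ζ.re / ‖ζ‖ ^ 2) := by
  have hlow : ∀ u : ℂ, ‖u‖ = ‖ζ‖ → 25 * ‖ζ‖ / 28 ≤ ‖w + u‖ := by
    intro u hu
    have := norm_sub_norm_le u (-w)
    rw [norm_neg, sub_neg_eq_add, add_comm] at this
    linarith
  have h1 : 25 * ‖ζ‖ / 28 ≤ ‖w + conj ζ‖ := hlow _ (Complex.norm_conj ζ)
  have h2 : 25 * ‖ζ‖ / 28 ≤ ‖w - ζ‖ := by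
    have := hlow (-ζ) (norm_neg ζ); rwa [← sub_eq_add_neg] at this
  have hpos : 0 < 25 * ‖ζ‖ / 28 := by positivity
  have hne1 : w + conj ζ ≠ 0 := norm_pos_iff.1 (lt_of_lt_of_le hpos h1)
  have hne2 : w - ζ ≠ 0 := norm_pos_iff.1 (lt_of_lt_of_le hpos h2)
  refine ⟨hne1, hne2, ?_⟩
  have e1 : e / (w + conj ζ) - e / (w - ζ) = -(e * (ζ + conj ζ)) / ((w + conj ζ) * (w - ζ)) := by
    field_simp
    ring
  have hsum : ζ + conj ζ = ((2 * ζ.re : ℝ) : ℂ) := Complex.add_conj ζ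
  rw [← Complex.sub_re, e1]
  refine le_trans (Complex.abs_re_le_norm _) ?_
  rw [norm_div, norm_neg, norm_mul, norm_mul, he, one_mul, hsum, Complex.norm_real,
    Real.norm_of_nonneg (by positivity), div_le_iff₀ (mul_pos (lt_of_lt_of_le hpos h1)
      (lt_of_lt_of_le hpos h2))]
  have hζ2 : 0 < ‖ζ‖ ^ 2 := by positivity
  have hprod : (25 * ‖ζ‖ / 28) * (25 * ‖ζ‖ / 28) ≤ ‖w + conj ζ‖ * ‖w - ζ‖ :=
    mul_le_mul h1 h2 hpos.le (le_trans hpos.le h1)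
  have : 2 * ζ.re ≤ 3 * (ζ.re / ‖ζ‖ ^ 2) * ((25 * ‖ζ‖ / 28) * (25 * ‖ζ‖ / 28)) := by
    rw [show 3 * (ζ.re / ‖ζ‖ ^ 2) * ((25 * ‖ζ‖ / 28) * (25 * ‖ζ‖ / 28)) =
      ζ.re * (3 * 625 / 784) by field_simp; ring]
    nlinarith
  exact le_trans this (mul_le_mul_of_nonneg_left hprod (by positivity))

/-- The Blaschke-pair value bound on the arc: for `‖ζ‖ > 14`, `Re ζ ≥ 0`, `‖e‖ = 1`, `Re e ≥ 0`:
`0 ≤ log‖e + conj ζ‖ − log‖e − ζ‖ ≤ 3 Re ζ/‖ζ‖²` (`‖e + conj ζ‖² − ‖e − ζ‖² = 4 Re e Re ζ`).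
[folklore] -/
private theorem blaschke_value_bound {ζ e : ℂ} (hζ : 14 < ‖ζ‖) (hre : 0 ≤ ζ.re) (he : ‖e‖ = 1)
    (here : 0 ≤ e.re) :
    0 ≤ Real.log ‖e + conj ζ‖ - Real.log ‖e - ζ‖ ∧
      Real.log ‖e + conj ζ‖ - Real.log ‖e - ζ‖ ≤ 3 * (ζ.re / ‖ζ‖ ^ 2) := by
  obtain ⟨hne1, hne2, -⟩ := blaschke_deriv_bound (w := e) hζ hre (by rw [he]; norm_num) he
  set a : ℝ := ‖e + conj ζ‖ with ha
  set b : ℝ := ‖e - ζ‖ with hb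
  have ha0 : 0 < a := norm_pos_iff.2 hne1
  have hb0 : 0 < b := norm_pos_iff.2 hne2
  have here1 : e.re ≤ 1 := le_trans (Complex.re_le_norm e) he.le
  have hsq : a ^ 2 = b ^ 2 + 4 * e.re * ζ.re := by
    rw [ha, hb, Complex.sq_norm, Complex.sq_norm, Complex.normSq_apply, Complex.normSq_apply]
    simp only [Complex.add_re, Complex.conj_re, Complex.add_im, Complex.conj_im, Complex.sub_re,
      Complex.sub_im]
    ring
  have hab : b ≤ a := by nlinarith
  have hb14 : 25 * ‖ζ‖ / 28 ≤ b := by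
    have := norm_sub_norm_le ζ e
    rw [norm_sub_rev] at this
    rw [hb]; linarith
  rw [← Real.log_div ha0.ne' hb0.ne']
  refine ⟨Real.log_nonneg ((one_le_div hb0).2 hab), ?_⟩
  refine le_trans (Real.log_le_sub_one_of_pos (div_pos ha0 hb0)) ?_
  have e1 : a / b - 1 = (a ^ 2 - b ^ 2) / ((a + b) * b) := by
    field_simp
    ring
  rw [e1, hsq, div_le_iff₀ (by positivity), show b ^ 2 + 4 * e.re * ζ.re - b ^ 2 = 4 * e.re * ζ.re by ring]
  have hζ2 : 0 < ‖ζ‖ ^ 2 := by positivity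
  have hprod : (25 * ‖ζ‖ / 28) * (25 * ‖ζ‖ / 28) ≤ b * b :=
    mul_le_mul hb14 hb14 (by positivity) hb0.le
  have h2 : 2 * ((25 * ‖ζ‖ / 28) * (25 * ‖ζ‖ / 28)) ≤ (a + b) * b := by nlinarith
  have : 4 * e.re * ζ.re ≤ 3 * (ζ.re / ‖ζ‖ ^ 2) * (2 * ((25 * ‖ζ‖ / 28) * (25 * ‖ζ‖ / 28))) := by
    rw [show 3 * (ζ.re / ‖ζ‖ ^ 2) * (2 * ((25 * ‖ζ‖ / 28) * (25 * ‖ζ‖ / 28))) =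
      ζ.re * (6 * 625 / 784) by field_simp; ring]
    nlinarith
  exact le_trans this (mul_le_mul_of_nonneg_left h2 (by positivity))

/-- The index set `{ρ ∈ NZ : Re ρ > 1/2}` sits inside the wave-0 zero set. [folklore] -/
private theorem indexSet_subset :
    {ρ : ℂ | ρ ∈ ZetaZeros.riemannZetaNontrivialZeros ∧ 1 / 2 < ρ.re} ⊆
      RHWave0.riemannZetaNontrivialZeros := by
  intro ρ hρ
  rw [riemannZetaNontrivialZeros_eq_wave0]
  exact hρ.1

/-- **Summability of `Σ_{Re ρ > 1/2} m(ρ) Re ζ_ρ/|ζ_ρ|²`** (from `Σ m(ρ)/|ρ|² < ∞`). [cite: Wang1946, eq. (8) (convergence of Σ β_ν/|ρ_ν|²)] -/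
theorem summable_order_mul_re_div_norm_sq :
    Summable fun ρ : {ρ : ℂ // ρ ∈ ZetaZeros.riemannZetaNontrivialZeros ∧ 1 / 2 < ρ.re} ↦
      (riemannZetaZeroOrder (ρ : ℂ) : ℝ) * (((ρ : ℂ) - 1 / 2).re / ‖(ρ : ℂ) - 1 / 2‖ ^ 2) := by
  have hF := FordL33.summable_order_div_norm_sq
  have h1 : Summable fun ρ : RHWave0.riemannZetaNontrivialZeros ↦
      (riemannZetaZeroOrder (ρ : ℂ) : ℝ) * (((ρ : ℂ) - 1 / 2).re / ‖(ρ : ℂ) - 1 / 2‖ ^ 2) := by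
    refine Summable.of_norm_bounded hF fun ρ ↦ ?_
    have hρ : (ρ : ℂ) ∈ ZetaZeros.riemannZetaNontrivialZeros := by
      rw [← riemannZetaNontrivialZeros_eq_wave0]; exact ρ.2
    obtain ⟨h14, -, hsq, hre⟩ := zero_sizes hρ
    have hm : (0 : ℝ) ≤ riemannZetaZeroOrder (ρ : ℂ) := (FordL33.order_pos ρ).le
    have hn0 : 0 < ‖(ρ : ℂ) - 1 / 2‖ ^ 2 := by positivity
    have hρ0 : 14 < ‖(ρ : ℂ)‖ := FordL33.fourteen_lt_norm ρ
    have hρ2 : 0 < ‖(ρ : ℂ)‖ ^ 2 := by positivity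
    rw [Real.norm_eq_abs, abs_mul, abs_of_nonneg hm, abs_div, abs_of_pos hn0,
      div_eq_mul_one_div _ (‖(ρ : ℂ)‖ ^ 2)]
    refine mul_le_mul_of_nonneg_left ?_ hm
    rw [div_le_div_iff₀ hn0 hρ2]
    nlinarith [abs_nonneg (((ρ : ℂ) - 1 / 2).re)]
  have := h1.comp_injective (Set.inclusion_injective indexSet_subset)
  exact this

/-- Facts about an index `ρ` (`Re ρ > 1/2`): `‖ζ_ρ‖ > 14`, `|Im ζ_ρ| > 1`, `Re ζ_ρ > 0`. [folklore] -/
private theorem zplus_facts (ρ : {ρ : ℂ // ρ ∈ ZetaZeros.riemannZetaNontrivialZeros ∧ 1 / 2 < ρ.re}) :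
    14 < ‖(ρ : ℂ) - 1 / 2‖ ∧ 1 < |((ρ : ℂ) - 1 / 2).im| ∧ 0 < ((ρ : ℂ) - 1 / 2).re := by
  obtain ⟨h14, him, -, -⟩ := zero_sizes ρ.2.1
  refine ⟨h14, him, ?_⟩
  have := ρ.2.2
  simp only [Complex.sub_re, one_div, Complex.inv_re, Complex.re_ofNat, Complex.normSq_ofNat]
  norm_num
  linarith

/-- The index type is countable. [folklore] -/
private theorem countable_indexSet :
    Countable {ρ : ℂ // ρ ∈ ZetaZeros.riemannZetaNontrivialZeros ∧ 1 / 2 < ρ.re} :=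
  (riemannZetaNontrivialZeros_countable.mono (fun ρ (h : ρ ∈ {ρ : ℂ |
    ρ ∈ ZetaZeros.riemannZetaNontrivialZeros ∧ 1 / 2 < ρ.re}) ↦ h.1)).to_subtype

/-- `r ↦ r e + c` has derivative `e`. [folklore] -/
private theorem hasDerivAt_lin (e c : ℂ) (r : ℝ) : HasDerivAt (fun y : ℝ ↦ (y : ℂ) * e + c) e r := by
  have := ((hasDerivAt_id' r).ofReal_comp.mul_const e).add_const c
  simpa using this

/-- `r ↦ r e − c` has derivative `e`. [folklore] -/
private theorem hasDerivAt_lin_sub (e c : ℂ) (r : ℝ) :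
    HasDerivAt (fun y : ℝ ↦ (y : ℂ) * e - c) e r := by
  have := ((hasDerivAt_id' r).ofReal_comp.mul_const e).sub_const c
  simpa using this

/-! ### §6 The Poisson–Jensen identity along a ray through the arc, differentiated at `r = 1` -/

/-- **The pointwise identity on the arc.** For `|θ| < π/2`, `e = e^{iθ}`, with
`φ(t) = log|ζ(1/2+it)|`, `P, ∂_r P` the Poisson kernel of the right half-plane and its radial
derivative, and `ζ_ρ = ρ − 1/2`:
`cos θ (Re(e ζ'/ζ(1/2+e)) + log|ζ(1/2+e)|) = cos θ (∫ ∂_rP(e,t) φ + ∫ P(e,t) φ) + cos θ (Re(e/(e+1/2)) − Re(e/(e−1/2)) + log|e+1/2| − log|e−1/2|) − Σ_ρ m(ρ) cos θ (Re(e/(e+conj ζ_ρ)) − Re(e/(e−ζ_ρ)) + log|e+conj ζ_ρ| − log|e−ζ_ρ|)`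
— the half-plane Poisson–Jensen formula on the ray `r e`, `1/2 < r < 3/2`, and its `r`-derivative at
`r = 1` (termwise differentiation of the zero sum). [cite: Wang1946, Lemma and eqs. (1)–(8); Titchmarsh1939, §3.62 (Poisson–Jensen)] -/
theorem arc_pointwise {θ : ℝ} (hθ : θ ∈ Ioo (-(π / 2)) (π / 2)) :
    (Summable fun ρ : {ρ : ℂ // ρ ∈ ZetaZeros.riemannZetaNontrivialZeros ∧ 1 / 2 < ρ.re} ↦
      (riemannZetaZeroOrder (ρ : ℂ) : ℝ) *
        ((cexp (θ * I) / (cexp (θ * I) + conj ((ρ : ℂ) - 1 / 2))).re -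
          (cexp (θ * I) / (cexp (θ * I) - ((ρ : ℂ) - 1 / 2))).re)) ∧
    (Summable fun ρ : {ρ : ℂ // ρ ∈ ZetaZeros.riemannZetaNontrivialZeros ∧ 1 / 2 < ρ.re} ↦
      (riemannZetaZeroOrder (ρ : ℂ) : ℝ) *
        (Real.log ‖cexp (θ * I) + conj ((ρ : ℂ) - 1 / 2)‖ -
          Real.log ‖cexp (θ * I) - ((ρ : ℂ) - 1 / 2)‖)) ∧
    Real.cos θ *
        ((cexp (θ * I) * deriv riemannZeta (1 / 2 + cexp (θ * I)) /
            riemannZeta (1 / 2 + cexp (θ * I))).re +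
          Real.log ‖riemannZeta (1 / 2 + cexp (θ * I))‖) =
      Real.cos θ *
          ((∫ t : ℝ, (π⁻¹ * (-(cexp (θ * I)) / ((cexp (θ * I)) - t * I) ^ 2).re) *
              Real.log ‖riemannZeta (1 / 2 + t * I)‖) +
            ∫ t : ℝ, (π⁻¹ * (1 / ((cexp (θ * I)) - t * I)).re) *
              Real.log ‖riemannZeta (1 / 2 + t * I)‖) +
        Real.cos θ *
          ((cexp (θ * I) / (cexp (θ * I) + 1 / 2)).re - (cexp (θ * I) / (cexp (θ * I) - 1 / 2)).re +
            (Real.log ‖cexp (θ * I) + 1 / 2‖ - Real.log ‖cexp (θ * I) - 1 / 2‖)) -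
        ∑' ρ : {ρ : ℂ // ρ ∈ ZetaZeros.riemannZetaNontrivialZeros ∧ 1 / 2 < ρ.re},
          (riemannZetaZeroOrder (ρ : ℂ) : ℝ) * (Real.cos θ *
            ((cexp (θ * I) / (cexp (θ * I) + conj ((ρ : ℂ) - 1 / 2))).re -
                (cexp (θ * I) / (cexp (θ * I) - ((ρ : ℂ) - 1 / 2))).re +
              (Real.log ‖cexp (θ * I) + conj ((ρ : ℂ) - 1 / 2)‖ -
                Real.log ‖cexp (θ * I) - ((ρ : ℂ) - 1 / 2)‖))) := by
  -- notation
  set e : ℂ := cexp (θ * I) with hedef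
  set φ : ℝ → ℝ := fun t ↦ Real.log ‖riemannZeta (1 / 2 + t * I)‖ with hφdef
  have hen : ‖e‖ = 1 := by rw [hedef, Complex.norm_exp_ofReal_mul_I]
  have here : e.re = Real.cos θ := by rw [hedef, Complex.exp_ofReal_mul_I_re]
  have hcos : 0 < Real.cos θ := Real.cos_pos_of_mem_Ioo hθ
  have he0 : 0 < e.re := by rw [here]; exact hcos
  have hφm : AEStronglyMeasurable φ volume := measurable_phi.aestronglyMeasurable
  have hφi : Integrable (fun t ↦ φ t / (1 + t ^ 2)) :=
    ZetaHalfPlanePoissonJensen.integrable_log_norm_riemannZeta_half_div_one_add_sq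
  -- the open interval of radii
  set s : Set ℝ := Ioo (1 / 2) (3 / 2) with hsdef
  have hs1 : (1 : ℝ) ∈ s := by rw [hsdef]; constructor <;> norm_num
  have hsn : s ∈ 𝓝 (1 : ℝ) := isOpen_Ioo.mem_nhds hs1
  have hnorm : ∀ r ∈ s, ‖(r : ℂ) * e‖ = r := by
    intro r hr
    rw [norm_mul, Complex.norm_real, hen, mul_one, Real.norm_of_nonneg (by linarith [hr.1])]
  have hre_r : ∀ r ∈ s, 0 < ((r : ℂ) * e).re := by
    intro r hr; rw [Complex.re_ofReal_mul]; exact mul_pos (by linarith [hr.1]) he0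
  have hne_half : ∀ r ∈ s, (r : ℂ) * e ≠ 1 / 2 := by
    intro r hr h
    have := congrArg (fun w : ℂ ↦ ‖w‖) h
    simp only [hnorm r hr] at this
    norm_num at this
    linarith [hr.1]
  have hζne : ∀ r ∈ s, riemannZeta (1 / 2 + (r : ℂ) * e) ≠ 0 := fun r hr ↦
    zeta_half_add_ne_zero (hre_r r hr) (by rw [hnorm r hr]; exact hr.1)
      (by rw [hnorm r hr]; exact hr.2.le)
  -- facts about the zeros
  have hZ := zplus_facts
  -- the zero-sum terms `g ρ r` and their derivatives `g' ρ r`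
  set m : {ρ : ℂ // ρ ∈ ZetaZeros.riemannZetaNontrivialZeros ∧ 1 / 2 < ρ.re} → ℝ :=
    fun ρ ↦ (riemannZetaZeroOrder (ρ : ℂ) : ℝ) with hmdef
  have hm0 : ∀ ρ, 0 ≤ m ρ := fun ρ ↦ by
    have h1 := ZetaZeros.riemannZetaNontrivialZeros.one_le_order ρ.2.1
    have h2 : (0 : ℝ) ≤ (riemannZetaZeroOrder (ρ : ℂ) : ℝ) := by exact_mod_cast (le_trans zero_le_one h1)
    simpa [hmdef] using h2
  set g : {ρ : ℂ // ρ ∈ ZetaZeros.riemannZetaNontrivialZeros ∧ 1 / 2 < ρ.re} → ℝ → ℝ :=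
    fun ρ r ↦ m ρ * (Real.log ‖(r : ℂ) * e + conj ((ρ : ℂ) - 1 / 2)‖ -
      Real.log ‖(r : ℂ) * e - ((ρ : ℂ) - 1 / 2)‖) with hgdef
  set g' : {ρ : ℂ // ρ ∈ ZetaZeros.riemannZetaNontrivialZeros ∧ 1 / 2 < ρ.re} → ℝ → ℝ :=
    fun ρ r ↦ m ρ * ((e / ((r : ℂ) * e + conj ((ρ : ℂ) - 1 / 2))).re -
      (e / ((r : ℂ) * e - ((ρ : ℂ) - 1 / 2))).re) with hg'def
  set u : {ρ : ℂ // ρ ∈ ZetaZeros.riemannZetaNontrivialZeros ∧ 1 / 2 < ρ.re} → ℝ :=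
    fun ρ ↦ 3 * (m ρ * ((((ρ : ℂ) - 1 / 2).re) / ‖(ρ : ℂ) - 1 / 2‖ ^ 2)) with hudef
  have hu : Summable u := (summable_order_mul_re_div_norm_sq.mul_left 3)
  have hB : ∀ ρ : {ρ : ℂ // ρ ∈ ZetaZeros.riemannZetaNontrivialZeros ∧ 1 / 2 < ρ.re}, ∀ r ∈ s,
      (r : ℂ) * e + conj ((ρ : ℂ) - 1 / 2) ≠ 0 ∧
      (r : ℂ) * e - ((ρ : ℂ) - 1 / 2) ≠ 0 ∧
      |(e / ((r : ℂ) * e + conj ((ρ : ℂ) - 1 / 2))).re -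
        (e / ((r : ℂ) * e - ((ρ : ℂ) - 1 / 2))).re| ≤
          3 * ((((ρ : ℂ) - 1 / 2).re) / ‖(ρ : ℂ) - 1 / 2‖ ^ 2) := by
    intro ρ r hr
    exact blaschke_deriv_bound (hZ ρ).1 (hZ ρ).2.2.le (by rw [hnorm r hr]; exact hr.2.le) hen
  have hgd : ∀ ρ, ∀ r ∈ s, HasDerivAt (g ρ) (g' ρ r) r := by
    intro ρ r hr
    obtain ⟨hne1, hne2, -⟩ := hB ρ r hr
    have h1 := hasDerivAt_log_norm (hasDerivAt_lin e (conj ((ρ : ℂ) - 1 / 2)) r) hne1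
    have h2 := hasDerivAt_log_norm (hasDerivAt_lin_sub e ((ρ : ℂ) - 1 / 2) r) hne2
    exact (h1.sub h2).const_mul (m ρ)
  have hgb : ∀ ρ, ∀ r ∈ s, ‖g' ρ r‖ ≤ u ρ := by
    intro ρ r hr
    obtain ⟨-, -, hb⟩ := hB ρ r hr
    rw [hg'def, hudef, Real.norm_eq_abs]
    simp only
    rw [abs_mul, abs_of_nonneg (hm0 ρ)]
    calc m ρ * |(e / ((r : ℂ) * e + conj ((ρ : ℂ) - 1 / 2))).re -
          (e / ((r : ℂ) * e - ((ρ : ℂ) - 1 / 2))).re|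
        ≤ m ρ * (3 * ((((ρ : ℂ) - 1 / 2).re) / ‖(ρ : ℂ) - 1 / 2‖ ^ 2)) :=
          mul_le_mul_of_nonneg_left hb (hm0 ρ)
      _ = 3 * (m ρ * ((((ρ : ℂ) - 1 / 2).re) / ‖(ρ : ℂ) - 1 / 2‖ ^ 2)) := by ring
  -- the Poisson–Jensen formula on the ray
  have hPJ : ∀ r ∈ s, HasSum (fun ρ ↦ g ρ r)
      ((∫ t : ℝ, (π⁻¹ * (1 / ((r : ℂ) * e - t * I)).re) * φ t) +
        Real.log ‖(r : ℂ) * e + 1 / 2‖ - Real.log ‖(r : ℂ) * e - 1 / 2‖ -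
          Real.log ‖riemannZeta (1 / 2 + (r : ℂ) * e)‖) := by
    intro r hr
    have h := (ZetaHalfPlanePoissonJensen.hasSum_poissonJensen_riemannZeta (hre_r r hr)
      (hne_half r hr) (hζne r hr)).2
    have hfun : (fun ρ : {ρ : ℂ // ρ ∈ ZetaZeros.riemannZetaNontrivialZeros ∧ 1 / 2 < ρ.re} ↦
        (riemannZetaZeroOrder (ρ : ℂ) : ℝ) *
          Real.log (‖(r : ℂ) * e + conj ((ρ : ℂ) - 1 / 2)‖ / ‖(r : ℂ) * e - ((ρ : ℂ) - 1 / 2)‖)) =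
        fun ρ ↦ g ρ r := by
      funext ρ
      obtain ⟨hne1, hne2, -⟩ := hB ρ r hr
      rw [hgdef, Real.log_div (norm_ne_zero_iff.2 hne1) (norm_ne_zero_iff.2 hne2)]
    rw [hfun] at h
    exact h
  -- termwise differentiation of the zero sum at `r = 1`
  have hT : HasDerivAt (fun r ↦ ∑' ρ, g ρ r) (∑' ρ, g' ρ 1) 1 :=
    hasDerivAt_tsum_of_isPreconnected hu isOpen_Ioo isPreconnected_Ioo hgd hgb hs1
      (hPJ 1 hs1).summable hs1
  -- the Poisson integral along the ray
  obtain ⟨-, -, hH⟩ := WangArc.hasDerivAt_poissonIntegral hφm hφi he0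
  -- the two pole logarithms
  have h1e : ((1 : ℝ) : ℂ) * e = e := by simp
  have hp1 : HasDerivAt (fun r : ℝ ↦ Real.log ‖(r : ℂ) * e + 1 / 2‖) ((e / (e + 1 / 2)).re) 1 := by
    have hne : ((1 : ℝ) : ℂ) * e + 1 / 2 ≠ 0 := by
      rw [h1e]; intro h
      have : ‖e‖ = ‖-(1 / 2 : ℂ)‖ := by rw [eq_neg_of_add_eq_zero_left h]
      rw [hen, norm_neg] at this; norm_num at this
    have := hasDerivAt_log_norm (hasDerivAt_lin e (1 / 2) 1) hne
    rwa [h1e] at this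
  have hp2 : HasDerivAt (fun r : ℝ ↦ Real.log ‖(r : ℂ) * e - 1 / 2‖) ((e / (e - 1 / 2)).re) 1 := by
    have hne : ((1 : ℝ) : ℂ) * e - 1 / 2 ≠ 0 := by
      rw [h1e]; intro h
      have : ‖e‖ = ‖(1 / 2 : ℂ)‖ := by rw [sub_eq_zero.1 h]
      rw [hen] at this; norm_num at this
    have := hasDerivAt_log_norm (hasDerivAt_lin_sub e (1 / 2) 1) hne
    rwa [h1e] at this
  -- `Λ(r) = log|ζ(1/2 + r e)|` and its derivative at `r = 1`
  have hγ : HasDerivAt (fun r : ℝ ↦ (1 : ℂ) / 2 + (r : ℂ) * e) e 1 := by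
    have := ((hasDerivAt_id' (1 : ℝ)).ofReal_comp.mul_const e).const_add ((1 : ℂ) / 2)
    simpa using this
  have hs1' : (1 : ℂ) / 2 + ((1 : ℝ) : ℂ) * e ≠ 1 := by
    rw [h1e]; exact half_add_expI_ne_one θ
  have hζ1 : riemannZeta (1 / 2 + e) ≠ 0 := by
    have := hζne 1 hs1; rwa [h1e] at this
  have hΛ : HasDerivAt (fun r : ℝ ↦ Real.log ‖riemannZeta (1 / 2 + (r : ℂ) * e)‖)
      ((deriv riemannZeta (1 / 2 + e) * e / riemannZeta (1 / 2 + e)).re) 1 := by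
    have hc := ((differentiableAt_riemannZeta hs1').hasDerivAt).comp (1 : ℝ) hγ
    rw [h1e] at hc
    have := hasDerivAt_log_norm (f := fun r : ℝ ↦ riemannZeta (1 / 2 + (r : ℂ) * e)) hc
      (by simp only [h1e]; exact hζ1)
    simp only [h1e] at this
    exact this
  -- the right-hand side of Poisson–Jensen as a function of `r`, and its derivative at `1`
  have hR : HasDerivAt (fun r : ℝ ↦ (∫ t : ℝ, (π⁻¹ * (1 / ((r : ℂ) * e - t * I)).re) * φ t) +
      Real.log ‖(r : ℂ) * e + 1 / 2‖ - Real.log ‖(r : ℂ) * e - 1 / 2‖ - ∑' ρ, g ρ r)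
      ((∫ t : ℝ, (π⁻¹ * (-e / (e - t * I) ^ 2).re) * φ t) + (e / (e + 1 / 2)).re -
        (e / (e - 1 / 2)).re - ∑' ρ, g' ρ 1) 1 :=
    ((hH.add hp1).sub hp2).sub hT
  have hEq : (fun r : ℝ ↦ Real.log ‖riemannZeta (1 / 2 + (r : ℂ) * e)‖) =ᶠ[𝓝 1]
      fun r : ℝ ↦ (∫ t : ℝ, (π⁻¹ * (1 / ((r : ℂ) * e - t * I)).re) * φ t) +
        Real.log ‖(r : ℂ) * e + 1 / 2‖ - Real.log ‖(r : ℂ) * e - 1 / 2‖ - ∑' ρ, g ρ r := by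
    filter_upwards [hsn] with r hr
    rw [(hPJ r hr).tsum_eq]
    ring
  have hstar := (hR.congr_of_eventuallyEq hEq).unique hΛ
  -- the value identity at `r = 1`
  have hstar2 := (hPJ 1 hs1).tsum_eq
  simp only [h1e] at hstar2
  -- summability of the two pieces at `r = 1`
  have hS1 : Summable fun ρ ↦ g' ρ 1 := by
    refine Summable.of_norm_bounded hu fun ρ ↦ hgb ρ 1 hs1
  have hS2 : Summable fun ρ ↦ g ρ 1 := (hPJ 1 hs1).summable
  have hS1' : Summable fun ρ : {ρ : ℂ // ρ ∈ ZetaZeros.riemannZetaNontrivialZeros ∧ 1 / 2 < ρ.re} ↦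
      m ρ * ((e / (e + conj ((ρ : ℂ) - 1 / 2))).re - (e / (e - ((ρ : ℂ) - 1 / 2))).re) := by
    refine hS1.congr fun ρ ↦ ?_
    simp only [hg'def, h1e]
  have hS2' : Summable fun ρ : {ρ : ℂ // ρ ∈ ZetaZeros.riemannZetaNontrivialZeros ∧ 1 / 2 < ρ.re} ↦
      m ρ * (Real.log ‖e + conj ((ρ : ℂ) - 1 / 2)‖ - Real.log ‖e - ((ρ : ℂ) - 1 / 2)‖) := by
    refine hS2.congr fun ρ ↦ ?_
    simp only [hgdef, h1e]
  refine ⟨hS1', hS2', ?_⟩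
  -- assemble
  have hT1 : ∑' ρ, g' ρ 1 = ∑' ρ : {ρ : ℂ // ρ ∈ ZetaZeros.riemannZetaNontrivialZeros ∧ 1 / 2 < ρ.re},
      m ρ * ((e / (e + conj ((ρ : ℂ) - 1 / 2))).re - (e / (e - ((ρ : ℂ) - 1 / 2))).re) :=
    tsum_congr fun ρ ↦ by simp only [hg'def, h1e]
  have hT2 : ∑' ρ, g ρ 1 = ∑' ρ : {ρ : ℂ // ρ ∈ ZetaZeros.riemannZetaNontrivialZeros ∧ 1 / 2 < ρ.re},
      m ρ * (Real.log ‖e + conj ((ρ : ℂ) - 1 / 2)‖ - Real.log ‖e - ((ρ : ℂ) - 1 / 2)‖) :=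
    tsum_congr fun ρ ↦ by simp only [hgdef, h1e]
  have hsum : ∑' ρ : {ρ : ℂ // ρ ∈ ZetaZeros.riemannZetaNontrivialZeros ∧ 1 / 2 < ρ.re},
      m ρ * (Real.cos θ * ((e / (e + conj ((ρ : ℂ) - 1 / 2))).re -
        (e / (e - ((ρ : ℂ) - 1 / 2))).re +
          (Real.log ‖e + conj ((ρ : ℂ) - 1 / 2)‖ - Real.log ‖e - ((ρ : ℂ) - 1 / 2)‖))) =
      Real.cos θ * ((∑' ρ, g' ρ 1) + ∑' ρ, g ρ 1) := by
    rw [hT1, hT2, ← hS1'.tsum_add hS2', ← tsum_mul_left]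
    refine tsum_congr fun ρ ↦ ?_
    ring
  rw [hsum]
  have hderiv_comm : (e * deriv riemannZeta (1 / 2 + e) / riemannZeta (1 / 2 + e)).re =
      (deriv riemannZeta (1 / 2 + e) * e / riemannZeta (1 / 2 + e)).re := by rw [mul_comm]
  rw [hderiv_comm, ← hstar]
  have hΛ1 : Real.log ‖riemannZeta (1 / 2 + e)‖ =
      (∫ t : ℝ, (π⁻¹ * (1 / (e - t * I)).re) * φ t) + Real.log ‖e + 1 / 2‖ -
        Real.log ‖e - 1 / 2‖ - ∑' ρ, g ρ 1 := by
    linarith [hstar2]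
  rw [hΛ1]
  simp only [hφdef]
  ring

/-! ### §7 The interior (zero) term: `∫ Σ_ρ = Σ_ρ ∫ = 2π S` -/

/-- **The zero term of Carleman's identity.** With `ζ_ρ = ρ − 1/2` over the zeros with `Re ρ > 1/2`:
`∫_{-π/2}^{π/2} Σ_ρ m(ρ) cos θ (Re(e/(e+conj ζ_ρ)) − Re(e/(e−ζ_ρ)) + log|e+conj ζ_ρ| − log|e−ζ_ρ|) dθ = 2π Σ_ρ m(ρ) Re ζ_ρ/|ζ_ρ|²`
(interchange of sum and integral by `Σ m(ρ)/|ζ_ρ|² < ∞`, then `WangArc.arcLog_blaschke_pair`).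
[cite: Wang1946, eq. (8) (the interior sum 2π Σ β_ν/|ρ_ν|² of Carleman's theorem); Titchmarsh1939, §3.71] -/
theorem zero_term_integral :
    ∫ θ in (-(π / 2))..(π / 2),
        ∑' ρ : {ρ : ℂ // ρ ∈ ZetaZeros.riemannZetaNontrivialZeros ∧ 1 / 2 < ρ.re},
          (riemannZetaZeroOrder (ρ : ℂ) : ℝ) * (Real.cos θ *
            ((cexp (θ * I) / (cexp (θ * I) + conj ((ρ : ℂ) - 1 / 2))).re -
                (cexp (θ * I) / (cexp (θ * I) - ((ρ : ℂ) - 1 / 2))).re +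
              (Real.log ‖cexp (θ * I) + conj ((ρ : ℂ) - 1 / 2)‖ -
                Real.log ‖cexp (θ * I) - ((ρ : ℂ) - 1 / 2)‖))) =
      2 * π * ∑' ρ : {ρ : ℂ // ρ ∈ ZetaZeros.riemannZetaNontrivialZeros ∧ 1 / 2 < ρ.re},
        (riemannZetaZeroOrder (ρ : ℂ) : ℝ) * ((((ρ : ℂ) - 1 / 2).re) / ‖(ρ : ℂ) - 1 / 2‖ ^ 2) := by
  haveI := countable_indexSet
  have hpi : -(π / 2) ≤ π / 2 := by linarith [Real.pi_pos]
  have hZ := zplus_facts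
  set m : {ρ : ℂ // ρ ∈ ZetaZeros.riemannZetaNontrivialZeros ∧ 1 / 2 < ρ.re} → ℝ :=
    fun ρ ↦ (riemannZetaZeroOrder (ρ : ℂ) : ℝ) with hmdef
  have hm0 : ∀ ρ, 0 ≤ m ρ := fun ρ ↦ by
    have h1 := ZetaZeros.riemannZetaNontrivialZeros.one_le_order ρ.2.1
    have h2 : (0 : ℝ) ≤ (riemannZetaZeroOrder (ρ : ℂ) : ℝ) := by
      exact_mod_cast (le_trans zero_le_one h1)
    simpa [hmdef] using h2
  set x : {ρ : ℂ // ρ ∈ ZetaZeros.riemannZetaNontrivialZeros ∧ 1 / 2 < ρ.re} → ℝ :=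
    fun ρ ↦ (((ρ : ℂ) - 1 / 2).re) / ‖(ρ : ℂ) - 1 / 2‖ ^ 2 with hxdef
  set F : {ρ : ℂ // ρ ∈ ZetaZeros.riemannZetaNontrivialZeros ∧ 1 / 2 < ρ.re} → ℝ → ℝ :=
    fun ρ θ ↦ m ρ * (Real.cos θ *
      ((cexp (θ * I) / (cexp (θ * I) + conj ((ρ : ℂ) - 1 / 2))).re -
          (cexp (θ * I) / (cexp (θ * I) - ((ρ : ℂ) - 1 / 2))).re +
        (Real.log ‖cexp (θ * I) + conj ((ρ : ℂ) - 1 / 2)‖ -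
          Real.log ‖cexp (θ * I) - ((ρ : ℂ) - 1 / 2)‖))) with hFdef
  have hE : Continuous fun θ : ℝ ↦ cexp (θ * I) :=
    Complex.continuous_exp.comp (Complex.continuous_ofReal.mul continuous_const)
  have hen : ∀ θ : ℝ, ‖cexp (θ * I)‖ = 1 := fun θ ↦ Complex.norm_exp_ofReal_mul_I θ
  -- nonvanishing and bounds for each zero
  have hB : ∀ ρ : {ρ : ℂ // ρ ∈ ZetaZeros.riemannZetaNontrivialZeros ∧ 1 / 2 < ρ.re}, ∀ θ : ℝ,
      cexp (θ * I) + conj ((ρ : ℂ) - 1 / 2) ≠ 0 ∧ cexp (θ * I) - ((ρ : ℂ) - 1 / 2) ≠ 0 ∧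
      |(cexp (θ * I) / (cexp (θ * I) + conj ((ρ : ℂ) - 1 / 2))).re -
        (cexp (θ * I) / (cexp (θ * I) - ((ρ : ℂ) - 1 / 2))).re| ≤ 3 * x ρ := fun ρ θ ↦
    blaschke_deriv_bound (hZ ρ).1 (hZ ρ).2.2.le (by rw [hen]; norm_num) (hen θ)
  -- continuity, integrability
  have hFc : ∀ ρ, Continuous (F ρ) := by
    intro ρ
    refine continuous_const.mul (Real.continuous_cos.mul (Continuous.add ?_ ?_))
    · exact (Complex.continuous_re.comp (hE.div (hE.add continuous_const) fun θ ↦ (hB ρ θ).1)).sub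
        (Complex.continuous_re.comp (hE.div (hE.sub continuous_const) fun θ ↦ (hB ρ θ).2.1))
    · exact ((continuous_norm.comp (hE.add continuous_const)).log
        fun θ ↦ norm_ne_zero_iff.2 (hB ρ θ).1).sub ((continuous_norm.comp
          (hE.sub continuous_const)).log fun θ ↦ norm_ne_zero_iff.2 (hB ρ θ).2.1)
  have hFi : ∀ ρ, Integrable (F ρ) (volume.restrict (Ioc (-(π / 2)) (π / 2))) := fun ρ ↦
    ((hFc ρ).integrableOn_Icc (a := -(π / 2)) (b := π / 2)).mono_set Ioc_subset_Icc_self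
  -- the uniform bound `|F ρ θ| ≤ 6 m(ρ) x(ρ)` on the arc
  have hFb : ∀ ρ, ∀ θ ∈ Ioc (-(π / 2)) (π / 2), ‖F ρ θ‖ ≤ 6 * (m ρ * x ρ) := by
    intro ρ θ hθ
    have hθ' : θ ∈ Icc (-(π / 2)) (π / 2) := Ioc_subset_Icc_self hθ
    have hcos : 0 ≤ Real.cos θ := Real.cos_nonneg_of_mem_Icc hθ'
    have hcos1 : Real.cos θ ≤ 1 := Real.cos_le_one θ
    obtain ⟨-, -, hb'⟩ := hB ρ θ
    obtain ⟨hb0, hb1⟩ := blaschke_value_bound (e := cexp (θ * I)) (hZ ρ).1 (hZ ρ).2.2.le (hen θ)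
      (by rw [Complex.exp_ofReal_mul_I_re]; exact hcos)
    rw [hFdef, Real.norm_eq_abs]
    simp only
    rw [abs_mul, abs_of_nonneg (hm0 ρ), abs_mul, abs_of_nonneg hcos]
    have hx0 : 0 ≤ x ρ := div_nonneg (hZ ρ).2.2.le (sq_nonneg _)
    have h1 : |(cexp (θ * I) / (cexp (θ * I) + conj ((ρ : ℂ) - 1 / 2))).re -
        (cexp (θ * I) / (cexp (θ * I) - ((ρ : ℂ) - 1 / 2))).re +
          (Real.log ‖cexp (θ * I) + conj ((ρ : ℂ) - 1 / 2)‖ -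
            Real.log ‖cexp (θ * I) - ((ρ : ℂ) - 1 / 2)‖)| ≤ 6 * x ρ := by
      refine le_trans (abs_add_le _ _) ?_
      rw [abs_of_nonneg hb0]
      linarith
    calc m ρ * (Real.cos θ * |(cexp (θ * I) / (cexp (θ * I) + conj ((ρ : ℂ) - 1 / 2))).re -
          (cexp (θ * I) / (cexp (θ * I) - ((ρ : ℂ) - 1 / 2))).re +
            (Real.log ‖cexp (θ * I) + conj ((ρ : ℂ) - 1 / 2)‖ -
              Real.log ‖cexp (θ * I) - ((ρ : ℂ) - 1 / 2)‖)|)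
        ≤ m ρ * (1 * (6 * x ρ)) := by
          refine mul_le_mul_of_nonneg_left ?_ (hm0 ρ)
          exact mul_le_mul hcos1 h1 (abs_nonneg _) zero_le_one
      _ = 6 * (m ρ * x ρ) := by ring
  -- summability of the integrated norms
  have hsx : Summable fun ρ ↦ m ρ * x ρ := summable_order_mul_re_div_norm_sq
  have hFn : Summable fun ρ ↦ ∫ θ in Ioc (-(π / 2)) (π / 2), ‖F ρ θ‖ := by
    refine Summable.of_nonneg_of_le (fun ρ ↦ integral_nonneg fun θ ↦ norm_nonneg _)
      (fun ρ ↦ ?_) ((hsx.mul_left 6).mul_right π)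
    calc ∫ θ in Ioc (-(π / 2)) (π / 2), ‖F ρ θ‖
        ≤ ∫ θ in Ioc (-(π / 2)) (π / 2), 6 * (m ρ * x ρ) := by
          refine setIntegral_mono_on (hFi ρ).norm (integrableOn_const (measure_Ioc_lt_top.ne))
            measurableSet_Ioc (hFb ρ)
      _ = 6 * (m ρ * x ρ) * π := by
          rw [setIntegral_const, smul_eq_mul, Real.volume_real_Ioc_of_le hpi]
          ring
  -- interchange
  have hsum := hasSum_integral_of_summable_integral_norm hFi hFn
  -- each integral
  have hval : ∀ ρ, ∫ θ in Ioc (-(π / 2)) (π / 2), F ρ θ = m ρ * (2 * π * x ρ) := by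
    intro ρ
    rw [← intervalIntegral.integral_of_le hpi, hFdef]
    simp only
    rw [intervalIntegral.integral_const_mul, WangArc.arcLog_blaschke_pair (hZ ρ).2.2 (hZ ρ).2.1]
  simp only [hval] at hsum
  have hsum2 : HasSum (fun ρ ↦ m ρ * (2 * π * x ρ)) (2 * π * ∑' ρ, m ρ * x ρ) := by
    have := (hsx.hasSum.mul_left (2 * π))
    refine this.congr_fun fun ρ ↦ ?_
    ring
  rw [intervalIntegral.integral_of_le hpi]
  exact hsum.unique hsum2

/-! ### §8 Wang's identity `W = A + π S` and the criterion -/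

/-- The pole-pair integrand is continuous. [folklore] -/
private theorem continuous_poleIntegrand :
    Continuous fun θ : ℝ ↦ Real.cos θ *
      ((cexp (θ * I) / (cexp (θ * I) + 1 / 2)).re - (cexp (θ * I) / (cexp (θ * I) - 1 / 2)).re +
        (Real.log ‖cexp (θ * I) + 1 / 2‖ - Real.log ‖cexp (θ * I) - 1 / 2‖)) := by
  have hE : Continuous fun θ : ℝ ↦ cexp (θ * I) :=
    Complex.continuous_exp.comp (Complex.continuous_ofReal.mul continuous_const)
  have hen : ∀ θ : ℝ, ‖cexp (θ * I)‖ = 1 := fun θ ↦ Complex.norm_exp_ofReal_mul_I θ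
  have h1 : ∀ θ : ℝ, cexp (θ * I) + 1 / 2 ≠ 0 := by
    intro θ h
    have : ‖cexp (θ * I)‖ = ‖-(1 / 2 : ℂ)‖ := by rw [eq_neg_of_add_eq_zero_left h]
    rw [hen, norm_neg] at this; norm_num at this
  have h2 : ∀ θ : ℝ, cexp (θ * I) - 1 / 2 ≠ 0 := by
    intro θ h
    have : ‖cexp (θ * I)‖ = ‖(1 / 2 : ℂ)‖ := by rw [sub_eq_zero.1 h]
    rw [hen] at this; norm_num at this
  refine Real.continuous_cos.mul (Continuous.add ?_ ?_)
  · exact (Complex.continuous_re.comp (hE.div (hE.add continuous_const) h1)).sub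
      (Complex.continuous_re.comp (hE.div (hE.sub continuous_const) h2))
  · exact ((continuous_norm.comp (hE.add continuous_const)).log
      fun θ ↦ norm_ne_zero_iff.2 (h1 θ)).sub
        ((continuous_norm.comp (hE.sub continuous_const)).log fun θ ↦ norm_ne_zero_iff.2 (h2 θ))

/-- **Wang's identity at `T = ∞`.** For every Wang arc logarithm `L`:
`∫_1^∞ log|ζ(1/2+it)| dt/t² = ∫_0^{π/2} Re(e^{-iθ} L(θ)) dθ + π Σ_{Re ρ > 1/2} m(ρ) Re(ρ − 1/2)/|ρ − 1/2|²`
(Wang: `= 2π Σ_{γ_ν > 0} β_ν/|ρ_ν|² + A`, the zeros `1/2 + ρ_ν` of `ζ` off the line being paired with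
their conjugates). [cite: Wang1946, final display p. 321 (T → ∞ in ∫_1^T log|ζ(1/2+it)| t^{-2} dt = 2π Σ β_ν/|ρ_ν|² + A + O(log T/T)); Broughan2017, Vol. 2 (Wang criterion)] -/
theorem wang_identity {L : ℝ → ℂ} (hL : IsWangArcLog L) :
    wangLogIntegral = (∫ θ in (0 : ℝ)..(π / 2), (cexp (-(θ * I)) * L θ).re) +
      π * ∑' ρ : {ρ : ℂ // ρ ∈ ZetaZeros.riemannZetaNontrivialZeros ∧ 1 / 2 < ρ.re},
        (riemannZetaZeroOrder (ρ : ℂ) : ℝ) * ((((ρ : ℂ) - 1 / 2).re) / ‖(ρ : ℂ) - 1 / 2‖ ^ 2) := by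
  have hpi : -(π / 2) ≤ π / 2 := by linarith [Real.pi_pos]
  -- the four integrals
  have h2A := arc_integral_eq_two_A hL
  obtain ⟨M, hM⟩ := phi_bounded
  have hφi := ZetaHalfPlanePoissonJensen.integrable_log_norm_riemannZeta_half_div_one_add_sq
  obtain ⟨hHI, hHval⟩ := WangArc.arc_poissonIntegral_eq measurable_phi.aestronglyMeasurable hφi hM
  rw [(integral_abs_gt_one_eq_two_W hφi).2] at hHval
  have hpole := WangArc.arcLog_pole_pair
  have hzero := zero_term_integral
  -- integrability of the pieces
  have hlhsI := continuousOn_arcIntegrand.intervalIntegrable_of_Icc (μ := volume) hpi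
  have hpoleI := continuous_poleIntegrand.intervalIntegrable (μ := volume) (-(π / 2)) (π / 2)
  -- the pointwise identity on the open arc
  have hpt := fun θ (hθ : θ ∈ Ioo (-(π / 2)) (π / 2)) ↦ (arc_pointwise hθ).2.2
  -- the zero term is integrable (it equals an integrable function on the open arc)
  have hTI : IntervalIntegrable (fun θ : ℝ ↦
      ∑' ρ : {ρ : ℂ // ρ ∈ ZetaZeros.riemannZetaNontrivialZeros ∧ 1 / 2 < ρ.re},
        (riemannZetaZeroOrder (ρ : ℂ) : ℝ) * (Real.cos θ *
          ((cexp (θ * I) / (cexp (θ * I) + conj ((ρ : ℂ) - 1 / 2))).re -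
              (cexp (θ * I) / (cexp (θ * I) - ((ρ : ℂ) - 1 / 2))).re +
            (Real.log ‖cexp (θ * I) + conj ((ρ : ℂ) - 1 / 2)‖ -
              Real.log ‖cexp (θ * I) - ((ρ : ℂ) - 1 / 2)‖)))) volume (-(π / 2)) (π / 2) := by
    have h := (hHI.add hpoleI).sub hlhsI
    rw [intervalIntegrable_iff_integrableOn_Ioo_of_le hpi] at h ⊢
    refine h.congr_fun (fun θ hθ ↦ ?_) measurableSet_Ioo
    have := hpt θ hθ
    dsimp only
    linarith
  -- integrate the pointwise identity
  have hint : ∫ θ in (-(π / 2))..(π / 2), Real.cos θ *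
      ((cexp (θ * I) * deriv riemannZeta (1 / 2 + cexp (θ * I)) /
          riemannZeta (1 / 2 + cexp (θ * I))).re +
        Real.log ‖riemannZeta (1 / 2 + cexp (θ * I))‖) =
      (∫ θ in (-(π / 2))..(π / 2), Real.cos θ *
          ((∫ t : ℝ, (π⁻¹ * (-(cexp (θ * I)) / ((cexp (θ * I)) - t * I) ^ 2).re) *
              Real.log ‖riemannZeta (1 / 2 + t * I)‖) +
            ∫ t : ℝ, (π⁻¹ * (1 / ((cexp (θ * I)) - t * I)).re) *
              Real.log ‖riemannZeta (1 / 2 + t * I)‖)) +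
        (∫ θ in (-(π / 2))..(π / 2), Real.cos θ *
          ((cexp (θ * I) / (cexp (θ * I) + 1 / 2)).re - (cexp (θ * I) / (cexp (θ * I) - 1 / 2)).re +
            (Real.log ‖cexp (θ * I) + 1 / 2‖ - Real.log ‖cexp (θ * I) - 1 / 2‖))) -
        ∫ θ in (-(π / 2))..(π / 2),
          ∑' ρ : {ρ : ℂ // ρ ∈ ZetaZeros.riemannZetaNontrivialZeros ∧ 1 / 2 < ρ.re},
            (riemannZetaZeroOrder (ρ : ℂ) : ℝ) * (Real.cos θ *
              ((cexp (θ * I) / (cexp (θ * I) + conj ((ρ : ℂ) - 1 / 2))).re -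
                  (cexp (θ * I) / (cexp (θ * I) - ((ρ : ℂ) - 1 / 2))).re +
                (Real.log ‖cexp (θ * I) + conj ((ρ : ℂ) - 1 / 2)‖ -
                  Real.log ‖cexp (θ * I) - ((ρ : ℂ) - 1 / 2)‖))) := by
    rw [← intervalIntegral.integral_add hHI hpoleI, ← intervalIntegral.integral_sub (hHI.add hpoleI) hTI]
    refine intervalIntegral.integral_congr_ae ?_
    have hae : ∀ᵐ θ : ℝ, θ ≠ π / 2 := by rw [ae_iff]; simp
    filter_upwards [hae] with θ hne hθ
    rw [uIoc_of_le hpi] at hθ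
    exact hpt θ ⟨hθ.1, lt_of_le_of_ne hθ.2 hne⟩
  rw [h2A, hHval, hpole, hzero] at hint
  linarith

/-- Each term of `S` is positive. [folklore] -/
private theorem S_term_pos (ρ : {ρ : ℂ // ρ ∈ ZetaZeros.riemannZetaNontrivialZeros ∧ 1 / 2 < ρ.re}) :
    0 < (riemannZetaZeroOrder (ρ : ℂ) : ℝ) * ((((ρ : ℂ) - 1 / 2).re) / ‖(ρ : ℂ) - 1 / 2‖ ^ 2) := by
  obtain ⟨h14, -, hre⟩ := zplus_facts ρ
  have h1 := ZetaZeros.riemannZetaNontrivialZeros.one_le_order ρ.2.1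
  have hm : (0 : ℝ) < (riemannZetaZeroOrder (ρ : ℂ) : ℝ) := by
    exact_mod_cast (lt_of_lt_of_le zero_lt_one h1)
  exact mul_pos hm (div_pos hre (by positivity))

/-! ### §9 The hypothesis `IsWangArcLog` is not vacuous -/

/-- **Existence of a Wang arc logarithm**: `L(θ) = Log ζ(3/2) + ∫_0^θ (ζ'/ζ)(1/2+e^{it}) i e^{it} dt`
is continuous on `[0, π/2]`, real at `0` (`ζ(3/2) > 0`) and satisfies `exp L(θ) = ζ(1/2 + e^{iθ})`
(`ζ ≠ 0` on the closed arc, RH-free). So `Wang1946_criterion` quantifies over a non-empty family,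
all of whose members agree on `[0, π/2]`. [cite: Wang1946, Lemma (the branch of log ζ(1/2+z) on the semicircle K, real on the real axis)] -/
theorem exists_isWangArcLog : ∃ L : ℝ → ℂ, IsWangArcLog L := by
  have hE : Continuous fun θ : ℝ ↦ cexp (θ * I) :=
    Complex.continuous_exp.comp (Complex.continuous_ofReal.mul continuous_const)
  set F : ℝ → ℂ := fun t ↦ riemannZeta (1 / 2 + cexp (t * I)) with hFdef
  set F' : ℝ → ℂ := fun t ↦ deriv riemannZeta (1 / 2 + cexp (t * I)) * (I * cexp (t * I))
    with hF'def
  set q : ℝ → ℂ := fun t ↦ F' t / F t with hqdef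
  set L : ℝ → ℂ := fun θ ↦ Complex.log (F 0) + ∫ t in (0 : ℝ)..θ, q t with hLdef
  have hFc : Continuous F := continuous_zeta_arc.1
  have hF'c : Continuous F' := continuous_zeta_arc.2.mul (continuous_const.mul hE)
  have hFd : ∀ θ : ℝ, HasDerivAt F (F' θ) θ := fun θ ↦ hasDerivAt_zeta_arc θ
  set U : Set ℝ := {t : ℝ | F t ≠ 0} with hUdef
  have hU : IsOpen U := isOpen_ne_fun hFc continuous_const
  have hsub : Icc (0 : ℝ) (π / 2) ⊆ U := fun t ht ↦
    zeta_arc_ne_zero ⟨by linarith [ht.1, Real.pi_pos], ht.2⟩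
  have hqc : ContinuousOn q U := hF'c.continuousOn.div hFc.continuousOn fun t ht ↦ ht
  -- `L' = q` on `[0, π/2]`
  have hLd : ∀ θ ∈ Icc (0 : ℝ) (π / 2), HasDerivAt L (q θ) θ := by
    intro θ hθ
    have hθU : θ ∈ U := hsub hθ
    have hi : IntervalIntegrable q volume 0 θ :=
      (hqc.mono ((Icc_subset_Icc le_rfl hθ.2).trans hsub)).intervalIntegrable_of_Icc hθ.1
    have h := intervalIntegral.integral_hasDerivAt_right hi
      (hqc.stronglyMeasurableAtFilter hU θ hθU) (hqc.continuousAt (hU.mem_nhds hθU))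
    exact h.const_add _
  have hLc : ContinuousOn L (Icc 0 (π / 2)) := fun θ hθ ↦ (hLd θ hθ).continuousAt.continuousWithinAt
  -- `F · exp(−L)` is constant `= 1` on `[0, π/2]`
  have hF0 : F 0 = riemannZeta ((3 / 2 : ℝ) : ℂ) := by
    simp only [hFdef, Complex.ofReal_zero, zero_mul, Complex.exp_zero]
    push_cast
    norm_num
  have hF0ne : F 0 ≠ 0 := hsub (left_mem_Icc.2 (by positivity))
  have hgd : ∀ θ ∈ Icc (0 : ℝ) (π / 2), HasDerivAt (fun θ ↦ F θ * cexp (-(L θ))) 0 θ := by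
    intro θ hθ
    have hne : F θ ≠ 0 := hsub hθ
    have h := (hFd θ).mul (hLd θ hθ).neg.cexp
    refine h.congr_deriv ?_
    rw [hqdef]
    field_simp
    ring
  have hgc : ContinuousOn (fun θ ↦ F θ * cexp (-(L θ))) (Icc 0 (π / 2)) := fun θ hθ ↦
    (hgd θ hθ).continuousAt.continuousWithinAt
  have hconst := constant_of_has_deriv_right_zero hgc
    (fun θ hθ ↦ (hgd θ (Ico_subset_Icc_self hθ)).hasDerivWithinAt)
  have hg0 : F 0 * cexp (-(L 0)) = 1 := by
    rw [hLdef]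
    simp only [intervalIntegral.integral_same, add_zero]
    rw [Complex.exp_neg, Complex.exp_log hF0ne, mul_inv_cancel₀ hF0ne]
  refine ⟨L, hLc, ?_, fun θ hθ ↦ ?_⟩
  · -- `Im L(0) = arg ζ(3/2) = 0`
    rw [hLdef]
    simp only [intervalIntegral.integral_same, add_zero]
    rw [Complex.log_im, hF0, Complex.arg_eq_zero_iff]
    exact ⟨(riemannZeta_re_pos_of_one_lt (by norm_num)).le, riemannZeta_im_eq_zero_of_one_lt (by norm_num)⟩
  · have h := hconst θ hθ
    rw [hg0, Complex.exp_neg, mul_inv_eq_one₀ (Complex.exp_ne_zero _)] at h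
    exact h.symm

end WangCriterion

open WangCriterion in
/-- **Wang's criterion (DISCHARGED).** For every continuous logarithm `L` of `ζ(1/2 + e^{iθ})` on
`[0, π/2]` that is real at `θ = 0`:
`RH ⟺ ∫_1^∞ log|ζ(1/2+it)| dt/t² = ∫_0^{π/2} Re(e^{-iθ} L(θ)) dθ`.
Proof: `W = A + π S` (`WangCriterion.wang_identity`) with `S = Σ_{Re ρ>1/2} m(ρ) Re(ρ−1/2)/|ρ−1/2|²`
a convergent sum of positive terms, and `S = 0 ⟺` no zero has `1/2 < Re ρ < 1 ⟺ RH`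
(`quasiRiemannHypothesis_one_half_iff_holds`). [cite: Wang1946, final display p. 321; Broughan2017, Vol. 2 (the Wang criterion)] -/
theorem Wang1946_criterion_holds : Wang1946_criterion := by
  intro L hL
  have hW := wang_identity hL
  set S : ℝ := ∑' ρ : {ρ : ℂ // ρ ∈ ZetaZeros.riemannZetaNontrivialZeros ∧ 1 / 2 < ρ.re},
    (riemannZetaZeroOrder (ρ : ℂ) : ℝ) * ((((ρ : ℂ) - 1 / 2).re) / ‖(ρ : ℂ) - 1 / 2‖ ^ 2) with hS
  have hsum := summable_order_mul_re_div_norm_sq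
  constructor
  · intro hRH
    have hq : QuasiRiemannHypothesis (1 / 2) := quasiRiemannHypothesis_one_half_iff_holds.2 hRH
    have hempty : IsEmpty {ρ : ℂ // ρ ∈ ZetaZeros.riemannZetaNontrivialZeros ∧ 1 / 2 < ρ.re} := by
      refine ⟨fun ⟨ρ, hmem, hre⟩ ↦ ?_⟩
      have hm := mem_riemannZetaNontrivialZeros_iff_holds.1 hmem
      exact hq ρ hm.1 hre hm.2.2
    have hS0 : S = 0 := tsum_empty
    rw [hW, hS0, mul_zero, add_zero]
  · intro heq
    have hS0 : S = 0 := by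
      have h1 : π * S = 0 := by linarith
      exact (mul_eq_zero.1 h1).resolve_left Real.pi_pos.ne'
    apply quasiRiemannHypothesis_one_half_iff_holds.1
    intro s hs h1 h2
    have hmem : s ∈ ZetaZeros.riemannZetaNontrivialZeros :=
      mem_riemannZetaNontrivialZeros_iff_holds.2 ⟨hs, by linarith, h2⟩
    have hle := le_hasSum hsum.hasSum ⟨s, hmem, h1⟩ (fun j _ ↦ (S_term_pos j).le)
    have : (∑' ρ : {ρ : ℂ // ρ ∈ ZetaZeros.riemannZetaNontrivialZeros ∧ 1 / 2 < ρ.re},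
      (riemannZetaZeroOrder (ρ : ℂ) : ℝ) * ((((ρ : ℂ) - 1 / 2).re) / ‖(ρ : ℂ) - 1 / 2‖ ^ 2)) = 0 := hS0
    rw [this] at hle
    exact absurd hle (not_le.2 (S_term_pos _))

end Literature.NumberTheory.LFunctions
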